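import Literature.AnabelianGeometry.AbsoluteAnabelian.MLFGaloisModel
import Literature.NumberTheory.GaloisRepresentations.CohomologicalDimension
import HarnessLib

/-!
# [AbsTopIII] Prop 3.2 (iv) / [IUTchII] Rmk 1.11.1 (i): the bi-anabelian statement for `k̄^×`
# transported from `AlgebraicClosure k` to an arbitrary algebraic closure (row "TLG lifting ⇐ LCFT
# facts by name", STAGE 2, brick 1)

Proof-only companion (theorems only, no new definitions).  The reduction
`MonoidKummerMapsTLGLiftReduction.lean` (this seat) takes as hypothesis the field-level sentence

  (BA)  `∀ (C₁ C₂ : MLFClosure) (α : Gal(C₁.K/C₁.k) ≃ₜ* Gal(C₂.K/C₂.k)), ∃ β : (C₁.K)⁰ ≃* (C₂.K)⁰` equivariant,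

for ARBITRARY algebraic closures `Cᵢ.K` (that is what the models of MLF-Galois pairs range over), whereas
the tree's local class field theory (abc-iut-L4-t11 / L6-t11 / L4-d1: `exists_isLocalReciprocityMap_holds`,
`galoisMLF_iso_unitImage_holds`, the reciprocity family) speaks about `Field.absoluteGaloisGroup k`, i.e.
about `AlgebraicClosure k`.  This file proves, once and for all, that the `AlgebraicClosure` form of (BA)
implies (BA) (S. Mochizuki, *Topics in Absolute Anabelian Geometry III*, Prop. 3.2 (iv) proof pp. 72–73
"via local class field theory [cf. [Mzk9], Proposition 1.2.1, (iii), (iv)]"; kurims manuscript, lit key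
`paper:url-5493eb38cbb7`), using the tree's independence-of-the-algebraic-closure isomorphism
`algEquivContinuousMulEquivAbsoluteGaloisGroup : (Ω ≃ₐ[K] Ω) ≃ₜ* absoluteGaloisGroup K`
(`CohomologicalDimension.lean`: conjugation by `IsAlgClosure.equiv`, continuous for the Krull topologies):

* `smul_algEquivContinuousMulEquivAbsoluteGaloisGroup` — how the transported automorphism acts on
  `AlgebraicClosure K`: `e(σ) • z = ψ (σ (ψ⁻¹ z))`, `ψ = IsAlgClosure.equiv K Ω (AlgebraicClosure K)`;
* `biAnabelianUnits_of_absoluteGaloisGroup` — (BA) for `(k, AlgebraicClosure k)` ⇒ (BA) for every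
  `MLFClosure`.

HONEST FRAMING: OUR kernel check of field-theoretic plumbing; nothing here bears on [IUTchIII] Cor. 3.12.
-/

noncomputable section

open scoped nonZeroDivisors

namespace Literature.AnabelianGeometry.AbsoluteAnabelian

open Field
open Literature.NumberTheory.GaloisRepresentations (algEquivContinuousMulEquivAbsoluteGaloisGroup)

universe u

/-! ### §1. How the transported Galois automorphism acts -/

/-- For an algebraic closure `Ω` of `K`, the element of `absoluteGaloisGroup K` corresponding to
`σ ∈ Aut_K(Ω)` under the tree's `algEquivContinuousMulEquivAbsoluteGaloisGroup K Ω` acts on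
`AlgebraicClosure K` by `z ↦ ψ (σ (ψ⁻¹ z))`, `ψ := IsAlgClosure.equiv K Ω (AlgebraicClosure K)` (the
absolute Galois group is well defined up to conjugation by an isomorphism of algebraic closures;
Neukirch, *Algebraic Number Theory*, Ch. IV §1). [cite: NeukirchANT1999, Ch. IV §1] -/
theorem smul_algEquivContinuousMulEquivAbsoluteGaloisGroup (K : Type u) [Field K] (Ω : Type u)
    [Field Ω] [Algebra K Ω] [IsAlgClosure K Ω] (σ : Ω ≃ₐ[K] Ω) (z : AlgebraicClosure K) :
    algEquivContinuousMulEquivAbsoluteGaloisGroup K Ω σ • z =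
      IsAlgClosure.equiv K Ω (AlgebraicClosure K) (σ ((IsAlgClosure.equiv K Ω (AlgebraicClosure K)).symm z)) := by
  show (AlgEquiv.autCongr (IsAlgClosure.equiv K Ω (AlgebraicClosure K)) σ) z = _
  rw [AlgEquiv.autCongr_apply]
  rfl

/-! ### §2. Transport of the bi-anabelian statement to arbitrary algebraic closures -/

/-- A field isomorphism restricts to a multiplicative bijection of the non-zero elements. [folklore] -/
private theorem exists_nonZeroDivisors_mulEquiv {L L' : Type*} [Field L] [Field L'] (φ : L ≃+* L') :
    ∃ γ : L⁰ ≃* L'⁰, ∀ x : L⁰, ((γ x : L'⁰) : L') = φ x := by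
  refine ⟨{ toFun := fun x => ⟨φ x, mem_nonZeroDivisors_of_ne_zero
              ((map_ne_zero φ).mpr (nonZeroDivisors.ne_zero x.2))⟩
            invFun := fun y => ⟨φ.symm y, mem_nonZeroDivisors_of_ne_zero
              ((map_ne_zero φ.symm).mpr (nonZeroDivisors.ne_zero y.2))⟩
            left_inv := fun x => Subtype.ext (φ.symm_apply_apply _)
            right_inv := fun y => Subtype.ext (φ.apply_symm_apply _)
            map_mul' := fun x y => Subtype.ext (by simp) }, fun _ => rfl⟩

/-- **(BA) for `AlgebraicClosure k` ⇒ (BA) for every algebraic closure.**  If for all MLFs `k₁, k₂`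
(valued form) every topological isomorphism `α₀ : G_{k₁} ⥲ G_{k₂}` of the absolute Galois groups
(`Field.absoluteGaloisGroup`, i.e. `Gal(AlgebraicClosure kᵢ / kᵢ)`) admits an `α₀`-equivariant
multiplicative bijection `(AlgebraicClosure k₁)^× ⥲ (AlgebraicClosure k₂)^×`, then the same holds for
the Galois groups and multiplicative groups of arbitrary algebraic closures `Cᵢ.K` (`MLFClosure`) — the
hypothesis (BA) of `MonoidKummerMapsTLGLiftReduction`.
[cite: MochizukiAbsTopIII2015, Proposition 3.2 (iv) p.72] -/
theorem biAnabelianUnits_of_absoluteGaloisGroup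
    (h : ∀ (k₁ : Type) [Field k₁] [ValuativeRel k₁] [TopologicalSpace k₁] [IsNonarchimedeanLocalField k₁]
        [CharZero k₁]
        (k₂ : Type) [Field k₂] [ValuativeRel k₂] [TopologicalSpace k₂] [IsNonarchimedeanLocalField k₂]
        [CharZero k₂]
        (α₀ : absoluteGaloisGroup k₁ ≃ₜ* absoluteGaloisGroup k₂),
      ∃ β₀ : (AlgebraicClosure k₁)⁰ ≃* (AlgebraicClosure k₂)⁰,
        ∀ (σ : absoluteGaloisGroup k₁) (x y : (AlgebraicClosure k₁)⁰),
          (y : AlgebraicClosure k₁) = σ • (x : AlgebraicClosure k₁) →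
          ((β₀ y : (AlgebraicClosure k₂)⁰) : AlgebraicClosure k₂) =
            α₀ σ • ((β₀ x : (AlgebraicClosure k₂)⁰) : AlgebraicClosure k₂))
    (C₁ C₂ : MLFClosure.{0}) (α : (C₁.K ≃ₐ[C₁.k] C₁.K) ≃ₜ* (C₂.K ≃ₐ[C₂.k] C₂.K)) :
    ∃ β : (C₁.K)⁰ ≃* (C₂.K)⁰, ∀ (σ : C₁.K ≃ₐ[C₁.k] C₁.K) (x y : (C₁.K)⁰), (y : C₁.K) = σ x →
      ((β y : (C₂.K)⁰) : C₂.K) = α σ ((β x : (C₂.K)⁰) : C₂.K) := by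
  -- the identifications `Cᵢ.K ≃ₐ AlgebraicClosure kᵢ` and `Aut(Cᵢ.K) ≃ₜ* G_{kᵢ}` (tree)
  let ψ₁ : C₁.K ≃ₐ[C₁.k] AlgebraicClosure C₁.k := IsAlgClosure.equiv C₁.k C₁.K (AlgebraicClosure C₁.k)
  let ψ₂ : C₂.K ≃ₐ[C₂.k] AlgebraicClosure C₂.k := IsAlgClosure.equiv C₂.k C₂.K (AlgebraicClosure C₂.k)
  let e₁ := algEquivContinuousMulEquivAbsoluteGaloisGroup C₁.k C₁.K
  let e₂ := algEquivContinuousMulEquivAbsoluteGaloisGroup C₂.k C₂.K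
  have he₁ : ∀ (σ : C₁.K ≃ₐ[C₁.k] C₁.K) (z : AlgebraicClosure C₁.k), e₁ σ • z = ψ₁ (σ (ψ₁.symm z)) :=
    fun σ z => smul_algEquivContinuousMulEquivAbsoluteGaloisGroup C₁.k C₁.K σ z
  have he₂ : ∀ (σ : C₂.K ≃ₐ[C₂.k] C₂.K) (z : AlgebraicClosure C₂.k), e₂ σ • z = ψ₂ (σ (ψ₂.symm z)) :=
    fun σ z => smul_algEquivContinuousMulEquivAbsoluteGaloisGroup C₂.k C₂.K σ z
  let α₀ : absoluteGaloisGroup C₁.k ≃ₜ* absoluteGaloisGroup C₂.k := e₁.symm.trans (α.trans e₂)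
  obtain ⟨β₀, hβ₀⟩ := h C₁.k C₂.k α₀
  obtain ⟨γ₁, hγ₁⟩ := exists_nonZeroDivisors_mulEquiv (ψ₁ : C₁.K ≃+* AlgebraicClosure C₁.k)
  obtain ⟨γ₂, hγ₂⟩ := exists_nonZeroDivisors_mulEquiv (ψ₂ : C₂.K ≃+* AlgebraicClosure C₂.k)
  refine ⟨γ₁.trans (β₀.trans γ₂.symm), fun σ x y hxy => ?_⟩
  -- `α₀ (e₁ σ) = e₂ (α σ)`
  have hα₀ : α₀ (e₁ σ) = e₂ (α σ) := by
    show e₂ (α (e₁.symm (e₁ σ))) = e₂ (α σ)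
    rw [ContinuousMulEquiv.symm_apply_apply]
  -- coordinates
  have hγ₁' : ∀ w : (C₁.K)⁰, ((γ₁ w : (AlgebraicClosure C₁.k)⁰) : AlgebraicClosure C₁.k) = ψ₁ (w : C₁.K) :=
    fun w => by rw [hγ₁, AlgEquiv.coe_ringEquiv]
  have hγ₂' : ∀ w : (AlgebraicClosure C₂.k)⁰, ((γ₂.symm w : (C₂.K)⁰) : C₂.K) =
      ψ₂.symm (w : AlgebraicClosure C₂.k) := by
    intro w
    have h1 := hγ₂ (γ₂.symm w)
    rw [MulEquiv.apply_symm_apply, AlgEquiv.coe_ringEquiv] at h1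
    -- h1 : (w : _) = ψ₂ (γ₂.symm w)
    rw [h1, AlgEquiv.symm_apply_apply]
  have hxy₀ : ((γ₁ y : (AlgebraicClosure C₁.k)⁰) : AlgebraicClosure C₁.k) =
      e₁ σ • ((γ₁ x : (AlgebraicClosure C₁.k)⁰) : AlgebraicClosure C₁.k) := by
    rw [hγ₁', hγ₁', he₁, AlgEquiv.symm_apply_apply, hxy]
  have key := hβ₀ (e₁ σ) (γ₁ x) (γ₁ y) hxy₀
  rw [hα₀, he₂] at key
  show ((γ₂.symm (β₀ (γ₁ y)) : (C₂.K)⁰) : C₂.K) = α σ ((γ₂.symm (β₀ (γ₁ x)) : (C₂.K)⁰) : C₂.K)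
  rw [hγ₂', hγ₂', key, AlgEquiv.symm_apply_apply]

end Literature.AnabelianGeometry.AbsoluteAnabelian

end
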